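import Mathlib
import HarnessLib
import Summits.HubbardSuperconductivity.HubbardSuperconductivity.Theorems.KLProgrammeC4aCompositeJetCounting
import Summits.HubbardSuperconductivity.HubbardSuperconductivity.Theorems.KLProgrammeC4aBubbleTubeDeriv
import Summits.HubbardSuperconductivity.HubbardSuperconductivity.Theorems.KLProgrammeC4aPartnerBandTangencyDefectFour

/-!
# Route `KLProgramme` — crux C4a, S3 brick (B3)/(B4) interface on the PARTNER BAND: the base-angle jets of the co-moving loop integrand
# `θ ↦ J(e,φ+θ)•Ψ(ē(e,φ;ρ,ϑ,θ))` carry ONE SMALL FACTOR of the partner band per Faà di Bruno block — every order, near tangency unconditionally (k ≤ 4)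

Cell `gate-hubbard-kl`, seat hubbard-kl-k3c3-p3 (g24; row «implicit-function / monotonicity route»).  Located brick «(B3)-ALL-ORDERS» for the
(C)-closer lane (stub (C) `stub_twoLeg_curvature` of `KLRegimeEngineV17F2`, stmt-HubbardSuperconductivity-20437; c4a-1 C4A-PLAN §24.4 / §24.9 (iii)).
`…C4aBubbleTubeDerivAll` puts every base-angle derivative of the loop / level integrals under the integral sign; `…C4aCompositeJetCounting` prices the
integrand's jet by «one small factor `α` per block»; this module connects the two to the (B2) files:

* §1 bridges (pure algebra, no hypotheses): the base-angle jets ARE the (B2) co-moving jets — `iteratedDeriv_partnerBand_pp_base_eq`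
  (`∂ᵏ_ψ|_θ e_K(Φ(0,ψ) + Φ(ρ,ϑ+ψ) − Φ(e,φ+ψ)) = ∂ᵏ_t|₀ e_K(S_{ρϑθ}(t) − Φ(e,φ+θ+t))`), `iteratedDeriv_partnerBand_ph_base_eq`, `iteratedDeriv_levelChartJac_base_eq`;
  `three_smallFactor_le` (`aφ² + b|e| + cδ ≤ (φ²+|e|+δ)(a+b+c)`).
* §2 (generic window `BandBounds a b`) **`norm_iteratedDeriv_loopIntegrand_pp_le_of_small_factor`** / `_ph_`: a Jacobian table `|∂ᵃ_s J(e,s)| ≤ Jt a` and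
  a small-factor hypothesis IN CO-MOVING FORM `|∂ʲ_t|₀ ē| ≤ α·G j` (`1 ≤ j ≤ n`) give
  `‖∂ⁿ_θ[J(e,φ+θ)•Ψ(ē)](θ)‖ ≤ Σ_{a=0}^{n} C(n,a)·Jt a·Σ_{c : OFP(n−a)} ‖Ψ^{(c.length)}(ē(θ))‖·(α^{c.length}·Π_j G|c_j|)` — region-agnostic (near (C)/(F) the
  closer feeds `α = |ρ| + |ϑ−π|` from `…C4aPartnerBandCooperDefect*`).
* §3 (the engine's window, `FrameOK`-type sizes with `A₅, A₆`) **`norm_iteratedDeriv_loopIntegrand_pp_tangency_le`** / `_ph_`: near the TANGENCY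
  configuration the small factor is `α = φ² + |e| + (|ρ| + |ϑ − ϑ_T|)` with `G j = (j+2)!·𝒦·(3𝒟)^{j+2} + (j+1)!·𝒦·R₁·D₁ʲ + (j+1)!·𝒦·R₂·D₂ʲ`, for EVERY
  `n ≤ 4`, UNCONDITIONALLY — `abs_iteratedDeriv_partnerBand_pp/ph_tangency_le_of_table` (k3c3-p3 g23) plugged into §2 by name.

So at order `n ≤ 4` the `L`-th derivative of the partner propagator is always paired with `(φ² + |e| + δ)^L` — §24.4's power counting input at (T),
ready for the fold-window calculus (`…C4aFoldLevelSetsPartnerBand`) of the (B4)-(T) closer.  Calculus inequalities on landed objects; the constants are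
closed-form expressions in the frame sizes, uniform in the frame `K`, n-free; nothing here asserts (C), the engine or superconductivity.
References: FST II CPAM 51 (1998) §3; BGM 2006 §2.4 (2.40) [cite: BenfattoGiulianiMastropietro2006].
-/

noncomputable section

namespace Summit.HubbardSuperconductivity.HubbardSuperconductivity.Theorems.C4a

set_option linter.dupNamespace false -- summit = problem name (single-conjunct summit), D-0017

open Real Set Filter Finset
open scoped Topology ContDiff
open Literature.MathematicalPhysics.QuantumLattice Literature.MathematicalPhysics.QuantumLattice.BandSectorCounting Literature.Probability.LatticeModels
open Summit.HubbardSuperconductivity.HubbardSuperconductivity.Theorems.KLRegimeSplit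
open Summit.HubbardSuperconductivity.HubbardSuperconductivity.Theorems.DispersionFlow
open Summit.HubbardSuperconductivity.HubbardSuperconductivity.Theorems.PerturbedFermiCurve

/-! ## §1 Bridges: base-angle jets = co-moving jets at `t = 0` -/

section Bridge

/-- **The base-angle jets of the pp partner band are the (B2) co-moving jets**:
`∂ᵏ_ψ|_θ e_K(Φ(0,ψ) + Φ(ρ,ϑ+ψ) − Φ(e,φ+ψ)) = ∂ᵏ_t|₀ e_K(S_{ρϑθ}(t) − Φ(e,φ+θ+t))` (translation `ψ = θ + t`). -/
theorem iteratedDeriv_partnerBand_pp_base_eq (μ : ℝ) (K : TrigPolyC4v) (ρ ϑ e φ θ : ℝ) (k : ℕ) :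
    iteratedDeriv k (fun ψ : ℝ => frameLevel μ K (levelPoint μ K 0 ψ + levelPoint μ K ρ (ϑ + ψ) - levelPoint μ K e (φ + ψ))) θ =
      iteratedDeriv k (fun t : ℝ => frameLevel μ K (pairSumPath μ K ρ ϑ θ t - levelPoint μ K e (φ + θ + t))) 0 := by
  set F : ℝ → ℝ := fun ψ => frameLevel μ K (levelPoint μ K 0 ψ + levelPoint μ K ρ (ϑ + ψ) - levelPoint μ K e (φ + ψ)) with hF
  have hfun : (fun t : ℝ => frameLevel μ K (pairSumPath μ K ρ ϑ θ t - levelPoint μ K e (φ + θ + t))) = fun t : ℝ => F (θ + t) := by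
    funext t; simp only [hF, pairSumPath, add_assoc]
  rw [hfun, iteratedDeriv_comp_const_add k F θ]
  simp only [add_zero]

/-- **The base-angle jets of the ph partner band are the (B2) co-moving jets**:
`∂ᵏ_ψ|_θ e_K(Φ(e,φ+ψ) − (Φ(0,ψ) − Φ(ρ,ϑ+ψ))) = ∂ᵏ_t|₀ e_K(Φ(e,φ+θ+t) − D_{ρϑθ}(t))`. -/
theorem iteratedDeriv_partnerBand_ph_base_eq (μ : ℝ) (K : TrigPolyC4v) (ρ ϑ e φ θ : ℝ) (k : ℕ) :
    iteratedDeriv k (fun ψ : ℝ => frameLevel μ K (levelPoint μ K e (φ + ψ) - (levelPoint μ K 0 ψ - levelPoint μ K ρ (ϑ + ψ)))) θ =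
      iteratedDeriv k (fun t : ℝ => frameLevel μ K (levelPoint μ K e (φ + θ + t) - pairDiffPath μ K ρ ϑ θ t)) 0 := by
  set F : ℝ → ℝ := fun ψ => frameLevel μ K (levelPoint μ K e (φ + ψ) - (levelPoint μ K 0 ψ - levelPoint μ K ρ (ϑ + ψ))) with hF
  have hfun : (fun t : ℝ => frameLevel μ K (levelPoint μ K e (φ + θ + t) - pairDiffPath μ K ρ ϑ θ t)) = fun t : ℝ => F (θ + t) := by
    funext t; simp only [hF, pairDiffPath, add_assoc]
  rw [hfun, iteratedDeriv_comp_const_add k F θ]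
  simp only [add_zero]

/-- The base-angle jets of the recentred Jacobian weight: `∂ᵃ_ψ|_θ J(e, φ+ψ) = ∂ᵃ_s J(e,·)(φ+θ)`. -/
theorem iteratedDeriv_levelChartJac_base_eq (μ : ℝ) (K : TrigPolyC4v) (e φ θ : ℝ) (a : ℕ) :
    iteratedDeriv a (fun ψ : ℝ => levelChartJac μ K (e, φ + ψ)) θ = iteratedDeriv a (fun s : ℝ => levelChartJac μ K (e, s)) (φ + θ) :=
  iteratedDeriv_comp_const_add_apply (fun s : ℝ => levelChartJac μ K (e, s)) φ θ a

/-- Three small terms under one small factor: `a·x + y·b + z·c ≤ (x + y + z)·(a + b + c)` for nonnegative data. -/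
theorem three_smallFactor_le {a b c x y z : ℝ} (ha : 0 ≤ a) (hb : 0 ≤ b) (hc : 0 ≤ c) (hx : 0 ≤ x) (hy : 0 ≤ y) (hz : 0 ≤ z) :
    a * x + y * b + z * c ≤ (x + y + z) * (a + b + c) := by
  nlinarith [mul_nonneg hx hb, mul_nonneg hx hc, mul_nonneg hy ha, mul_nonneg hy hc, mul_nonneg hz ha, mul_nonneg hz hb]

end Bridge

/-! ## §2 Region-agnostic counting for the co-moving loop integrand (generic window) -/

section Generic

variable {a b : ℝ} (B : BandBounds a b) {K : TrigPolyC4v} {A : ℝ}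
  (hA : ∀ p : Momentum, ∀ j ≤ 2, ‖iteratedFDeriv ℝ j (frameShift K) p‖ ≤ A) (hADt : 2 * A < B.Dtmin)
  {μ r : ℝ} (hlo : a < μ - r - A) (hhi : μ + r + A < b)
include B hA hADt hlo hhi

/-- The base-angle pp partner band is `C^∞`. -/
theorem contDiff_partnerBand_pp_base {ρ e : ℝ} (hρ : |ρ| < r) (he : |e| < r) (ϑ φ : ℝ) {n : ℕ∞} :
    ContDiff ℝ n fun ψ : ℝ => frameLevel μ K (levelPoint μ K 0 ψ + levelPoint μ K ρ (ϑ + ψ) - levelPoint μ K e (φ + ψ)) := by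
  have h0 : |(0 : ℝ)| < r := by rw [abs_zero]; exact (abs_nonneg e).trans_lt he
  have hl : ∀ {x : ℝ}, |x| < r → ContDiff ℝ n (levelPoint μ K x) := fun hx => contDiff_levelPoint_angle B hA hADt hlo hhi hx
  exact (EngineV8.contDiff_frameLevel μ K).comp
    (((hl h0).add ((hl hρ).comp (contDiff_const.add contDiff_id))).sub ((hl he).comp (contDiff_const.add contDiff_id)))

/-- The base-angle ph partner band is `C^∞`. -/
theorem contDiff_partnerBand_ph_base {ρ e : ℝ} (hρ : |ρ| < r) (he : |e| < r) (ϑ φ : ℝ) {n : ℕ∞} :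
    ContDiff ℝ n fun ψ : ℝ => frameLevel μ K (levelPoint μ K e (φ + ψ) - (levelPoint μ K 0 ψ - levelPoint μ K ρ (ϑ + ψ))) := by
  have h0 : |(0 : ℝ)| < r := by rw [abs_zero]; exact (abs_nonneg e).trans_lt he
  have hl : ∀ {x : ℝ}, |x| < r → ContDiff ℝ n (levelPoint μ K x) := fun hx => contDiff_levelPoint_angle B hA hADt hlo hhi hx
  exact (EngineV8.contDiff_frameLevel μ K).comp
    (((hl he).comp (contDiff_const.add contDiff_id)).sub ((hl h0).sub ((hl hρ).comp (contDiff_const.add contDiff_id))))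

/-- **SMALL-FACTOR COUNTING FOR THE CO-MOVING pp INTEGRAND (any region).**  A Jacobian table `|∂ᵃ_s J(e,s)| ≤ Jt a` (`a ≤ n`, all `s`) and one small
factor per co-moving jet of the partner band, `|∂ʲ_t|₀ e_K(S_{ρϑθ}(t) − Φ(e,φ+θ+t))| ≤ α·G j` (`1 ≤ j ≤ n`), give
`‖∂ⁿ_ψ|_θ [J(e,φ+ψ)•Ψ(ē(ψ))]‖ ≤ Σ_{a=0}^{n} C(n,a)·Jt a·Σ_{c : OFP(n−a)} ‖Ψ^{(c.length)}(ē(θ))‖·(α^{c.length}·Π_j G|c_j|)`. -/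
theorem norm_iteratedDeriv_loopIntegrand_pp_le_of_small_factor {Ψ : ℝ → ℂ} (hΨ : ContDiff ℝ ∞ Ψ) {ρ e : ℝ} (hρ : |ρ| < r) (he : |e| < r)
    (ϑ φ θ : ℝ) {n : ℕ} {Jt : ℕ → ℝ} (hJt : ∀ a ≤ n, ∀ s, |iteratedDeriv a (fun s : ℝ => levelChartJac μ K (e, s)) s| ≤ Jt a)
    {α : ℝ} {G : ℕ → ℝ}
    (hG : ∀ j, 1 ≤ j → j ≤ n → |iteratedDeriv j (fun t : ℝ => frameLevel μ K (pairSumPath μ K ρ ϑ θ t - levelPoint μ K e (φ + θ + t))) 0| ≤ α * G j) :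
    ‖iteratedDeriv n (fun ψ : ℝ => (levelChartJac μ K (e, φ + ψ) : ℝ) •
        Ψ (frameLevel μ K (levelPoint μ K 0 ψ + levelPoint μ K ρ (ϑ + ψ) - levelPoint μ K e (φ + ψ)))) θ‖ ≤
      ∑ a ∈ Finset.range (n + 1), (n.choose a : ℝ) * Jt a *
        ∑ c : OrderedFinpartition (n - a),
          ‖iteratedDeriv c.length Ψ (frameLevel μ K (levelPoint μ K 0 θ + levelPoint μ K ρ (ϑ + θ) - levelPoint μ K e (φ + θ)))‖ *
            (α ^ c.length * ∏ j, G (c.partSize j)) := by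
  have hJ : ContDiff ℝ n (fun s : ℝ => levelChartJac μ K (e, s)) := (contDiff_levelChartJac_angle B hA hADt hlo hhi he).of_le (mod_cast le_top)
  have hg : ContDiff ℝ n (fun ψ : ℝ => frameLevel μ K (levelPoint μ K 0 ψ + levelPoint μ K ρ (ϑ + ψ) - levelPoint μ K e (φ + ψ))) :=
    contDiff_partnerBand_pp_base B hA hADt hlo hhi hρ he ϑ φ
  have hG' : ∀ j, 1 ≤ j → j ≤ n →
      |iteratedDeriv j (fun ψ : ℝ => frameLevel μ K (levelPoint μ K 0 ψ + levelPoint μ K ρ (ϑ + ψ) - levelPoint μ K e (φ + ψ))) θ| ≤ α * G j :=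
    fun j hj1 hj2 => by rw [iteratedDeriv_partnerBand_pp_base_eq]; exact hG j hj1 hj2
  exact norm_iteratedDeriv_weight_smul_scomp_le hJ (hΨ.of_le (mod_cast le_top)) hg hJt hG' φ

/-- **SMALL-FACTOR COUNTING FOR THE CO-MOVING ph INTEGRAND (any region)** — the same with the ph partner band `e_K(Φ(e,φ+θ+t) − D_{ρϑθ}(t))`. -/
theorem norm_iteratedDeriv_loopIntegrand_ph_le_of_small_factor {Ψ : ℝ → ℂ} (hΨ : ContDiff ℝ ∞ Ψ) {ρ e : ℝ} (hρ : |ρ| < r) (he : |e| < r)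
    (ϑ φ θ : ℝ) {n : ℕ} {Jt : ℕ → ℝ} (hJt : ∀ a ≤ n, ∀ s, |iteratedDeriv a (fun s : ℝ => levelChartJac μ K (e, s)) s| ≤ Jt a)
    {α : ℝ} {G : ℕ → ℝ}
    (hG : ∀ j, 1 ≤ j → j ≤ n → |iteratedDeriv j (fun t : ℝ => frameLevel μ K (levelPoint μ K e (φ + θ + t) - pairDiffPath μ K ρ ϑ θ t)) 0| ≤ α * G j) :
    ‖iteratedDeriv n (fun ψ : ℝ => (levelChartJac μ K (e, φ + ψ) : ℝ) •
        Ψ (frameLevel μ K (levelPoint μ K e (φ + ψ) - (levelPoint μ K 0 ψ - levelPoint μ K ρ (ϑ + ψ))))) θ‖ ≤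
      ∑ a ∈ Finset.range (n + 1), (n.choose a : ℝ) * Jt a *
        ∑ c : OrderedFinpartition (n - a),
          ‖iteratedDeriv c.length Ψ (frameLevel μ K (levelPoint μ K e (φ + θ) - (levelPoint μ K 0 θ - levelPoint μ K ρ (ϑ + θ))))‖ *
            (α ^ c.length * ∏ j, G (c.partSize j)) := by
  have hJ : ContDiff ℝ n (fun s : ℝ => levelChartJac μ K (e, s)) := (contDiff_levelChartJac_angle B hA hADt hlo hhi he).of_le (mod_cast le_top)
  have hg : ContDiff ℝ n (fun ψ : ℝ => frameLevel μ K (levelPoint μ K e (φ + ψ) - (levelPoint μ K 0 ψ - levelPoint μ K ρ (ϑ + ψ)))) :=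
    contDiff_partnerBand_ph_base B hA hADt hlo hhi hρ he ϑ φ
  have hG' : ∀ j, 1 ≤ j → j ≤ n →
      |iteratedDeriv j (fun ψ : ℝ => frameLevel μ K (levelPoint μ K e (φ + ψ) - (levelPoint μ K 0 ψ - levelPoint μ K ρ (ϑ + ψ)))) θ| ≤ α * G j :=
    fun j hj1 hj2 => by rw [iteratedDeriv_partnerBand_ph_base_eq]; exact hG j hj1 hj2
  exact norm_iteratedDeriv_weight_smul_scomp_le hJ (hΨ.of_le (mod_cast le_top)) hg hJt hG' φ

end Generic

/-! ## §3 Near the tangency configuration: every order `n ≤ 4`, unconditionally -/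

section Tangency

variable {K : TrigPolyC4v} {A : ℝ} (hA : ∀ p : Momentum, ∀ j ≤ 2, ‖iteratedFDeriv ℝ j (frameShift K) p‖ ≤ A) (hA20 : A ≤ 1 / 20)
  (hd : klCurveD ≤ (bandBounds (show (-4 : ℝ) < -1.1 by norm_num) (show (-1.1 : ℝ) ≤ -0.1 by norm_num)
    (show (-0.1 : ℝ) < 0 by norm_num)).Dtmin - 2 * A)
  {μ r : ℝ} (hr : 0 < r) (hlo : (-1.1 : ℝ) < μ - r - A) (hhi : μ + r + A < -0.1)
  {A₃ A₄ A₅ A₆ : ℝ} (hA₃ : ∀ p : Momentum, ‖iteratedFDeriv ℝ 3 (frameShift K) p‖ ≤ A₃)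
  (hA₄ : ∀ p : Momentum, ‖iteratedFDeriv ℝ 4 (frameShift K) p‖ ≤ A₄)
  (hA₅ : ∀ p : Momentum, ‖iteratedFDeriv ℝ 5 (frameShift K) p‖ ≤ A₅)
  (hA₆ : ∀ p : Momentum, ‖iteratedFDeriv ℝ 6 (frameShift K) p‖ ≤ A₆)
include hA hA20 hd hr hlo hhi hA₃ hA₄ hA₅ hA₆

/-- **THE CO-MOVING pp INTEGRAND NEAR TANGENCY: ONE SMALL FACTOR `φ² + |e| + (|ρ|+|ϑ|)` PER BLOCK, EVERY ORDER `n ≤ 4`, UNCONDITIONAL.**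
With the data of `abs_iteratedDeriv_partnerBand_pp_tangency_le_of_table` at level `n` (band rows `𝒦`, curve base `𝒟`, reciprocal table `Q`, row bases
`D₁,R₁,D₂,R₂`), a Jacobian table `|∂ᵃ_s J(e,s)| ≤ Jt a` (`a ≤ n`) and any smooth `Ψ`:
`‖∂ⁿ_ψ|_θ[J(e,φ+ψ)•Ψ(ē(ψ))]‖ ≤ Σ_{a=0}^{n} C(n,a)·Jt a·Σ_{c : OFP(n−a)} ‖Ψ^{(c.length)}(ē(θ))‖·(α^{c.length}·Π_j G|c_j|)`,
`α = φ² + |e| + (|ρ|+|ϑ|)`, `G j = (j+2)!·𝒦·(3𝒟)^{j+2} + (j+1)!·𝒦·R₁·D₁ʲ + (j+1)!·𝒦·R₂·D₂ʲ`. -/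
theorem norm_iteratedDeriv_loopIntegrand_pp_tangency_le {n : ℕ} (hn : n ≤ 4) {𝒦 𝒟 : ℝ}
    (hK : ∀ i, 1 ≤ i → i ≤ n + 2 → ∀ p : Momentum, ‖iteratedFDeriv ℝ i (frameLevel μ K) p‖ ≤ 𝒦) (h𝒟 : 1 ≤ 𝒟)
    (hD : ∀ i, 1 ≤ i → i ≤ n + 2 → msD6 A₃ A₄ A₅ A₆ i ≤ 𝒟 ^ i) {Q : ℕ → ℝ}
    (hQ0 : ((bandBounds (show (-4 : ℝ) < -1.1 by norm_num) (show (-1.1 : ℝ) ≤ -0.1 by norm_num) (show (-0.1 : ℝ) < 0 by norm_num)).Dtmin - 2 * A)⁻¹ ≤ Q 0)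
    (hQ : ∀ m, 1 ≤ m → m ≤ n → ((bandBounds (show (-4 : ℝ) < -1.1 by norm_num) (show (-1.1 : ℝ) ≤ -0.1 by norm_num)
        (show (-0.1 : ℝ) < 0 by norm_num)).Dtmin - 2 * A)⁻¹ *
        ∑ j ∈ Finset.range m, (m.choose j : ℝ) * Q j * ((m - j + 1).factorial * 𝒦 * 𝒟 ^ (m - j)) ≤ Q m)
    {ρ : ℝ} (hρ : |ρ| < r) {e : ℝ} (he : |e| < r) (ϑ : ℝ) {D₁ R₁ D₂ R₂ : ℝ} (hD₁0 : 0 ≤ D₁) (hR₁0 : 0 ≤ R₁) (hD₂0 : 0 ≤ D₂) (hR₂0 : 0 ≤ R₂)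
    (hD₁ : ∀ j, 1 ≤ j → j ≤ n → 3 * msD6 A₃ A₄ A₅ A₆ j + |e| * (∑ l ∈ Finset.range (j + 1), (j.choose l : ℝ) * Q l) ≤ D₁ ^ j)
    (hR₁ : ∀ j, j ≤ n → (∑ l ∈ Finset.range (j + 1), (j.choose l : ℝ) * Q l) ≤ R₁ * D₁ ^ j)
    (hD₂ : ∀ j, 1 ≤ j → j ≤ n →
      3 * msD6 A₃ A₄ A₅ A₆ j + (|ρ| + |ϑ|) * ((∑ l ∈ Finset.range (j + 1), (j.choose l : ℝ) * Q l) + msD6 A₃ A₄ A₅ A₆ (j + 1)) ≤ D₂ ^ j)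
    (hR₂ : ∀ j, j ≤ n → (∑ l ∈ Finset.range (j + 1), (j.choose l : ℝ) * Q l) + msD6 A₃ A₄ A₅ A₆ (j + 1) ≤ R₂ * D₂ ^ j)
    {Ψ : ℝ → ℂ} (hΨ : ContDiff ℝ ∞ Ψ) {Jt : ℕ → ℝ} (hJt : ∀ a ≤ n, ∀ s, |iteratedDeriv a (fun s : ℝ => levelChartJac μ K (e, s)) s| ≤ Jt a)
    (θ φ : ℝ) :
    ‖iteratedDeriv n (fun ψ : ℝ => (levelChartJac μ K (e, φ + ψ) : ℝ) •
        Ψ (frameLevel μ K (levelPoint μ K 0 ψ + levelPoint μ K ρ (ϑ + ψ) - levelPoint μ K e (φ + ψ)))) θ‖ ≤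
      ∑ a ∈ Finset.range (n + 1), (n.choose a : ℝ) * Jt a *
        ∑ c : OrderedFinpartition (n - a),
          ‖iteratedDeriv c.length Ψ (frameLevel μ K (levelPoint μ K 0 θ + levelPoint μ K ρ (ϑ + θ) - levelPoint μ K e (φ + θ)))‖ *
            ((φ ^ 2 + |e| + (|ρ| + |ϑ|)) ^ c.length *
              ∏ j, ((c.partSize j + 2).factorial * 𝒦 * (3 * 𝒟) ^ (c.partSize j + 2) + (c.partSize j + 1).factorial * 𝒦 * R₁ * D₁ ^ c.partSize j +
                (c.partSize j + 1).factorial * 𝒦 * R₂ * D₂ ^ c.partSize j)) := by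
  set B₀ := bandBounds (show (-4 : ℝ) < -1.1 by norm_num) (show (-1.1 : ℝ) ≤ -0.1 by norm_num) (show (-0.1 : ℝ) < 0 by norm_num) with hB₀
  have hADt : 2 * A < B₀.Dtmin := by have := klCurveD_pos; linarith
  have h𝒦 : 0 ≤ 𝒦 := (norm_nonneg _).trans (hK 1 le_rfl (by omega) 0)
  refine norm_iteratedDeriv_loopIntegrand_pp_le_of_small_factor B₀ hA hADt hlo hhi hΨ hρ he ϑ φ θ hJt
    (G := fun j => (j + 2).factorial * 𝒦 * (3 * 𝒟) ^ (j + 2) + (j + 1).factorial * 𝒦 * R₁ * D₁ ^ j + (j + 1).factorial * 𝒦 * R₂ * D₂ ^ j)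
    fun j hj1 hj2 => ?_
  have hjk : j ≤ 4 := hj2.trans hn
  have h := abs_iteratedDeriv_partnerBand_pp_tangency_le_of_table hA hA20 hd hr hlo hhi hA₃ hA₄ hA₅ hA₆ hjk
    (fun i hi1 hi2 p => hK i hi1 (by omega) p) h𝒟 (fun i hi1 hi2 => hD i hi1 (by omega)) hQ0 (fun m hm1 hm2 => hQ m hm1 (hm2.trans hj2))
    hρ he ϑ hD₁0 hR₁0 hD₂0 hR₂0 (fun i hi1 hi2 => hD₁ i hi1 (hi2.trans hj2)) (fun i hi => hR₁ i (hi.trans hj2))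
    (fun i hi1 hi2 => hD₂ i hi1 (hi2.trans hj2)) (fun i hi => hR₂ i (hi.trans hj2)) θ φ
  refine h.trans ?_
  have h3 := three_smallFactor_le (a := (j + 2).factorial * 𝒦 * (3 * 𝒟) ^ (j + 2)) (b := (j + 1).factorial * 𝒦 * R₁ * D₁ ^ j)
    (c := (j + 1).factorial * 𝒦 * R₂ * D₂ ^ j) (x := φ ^ 2) (y := |e|) (z := |ρ| + |ϑ|)
    (by positivity) (by positivity) (by positivity) (by positivity) (abs_nonneg _) (by positivity)
  simpa only using h3

/-- **THE CO-MOVING ph INTEGRAND NEAR `2k_F`: ONE SMALL FACTOR `φ² + |e| + (|ρ|+|ϑ−π|)` PER BLOCK, EVERY ORDER `n ≤ 4`, UNCONDITIONAL** (same data). -/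
theorem norm_iteratedDeriv_loopIntegrand_ph_tangency_le {n : ℕ} (hn : n ≤ 4) {𝒦 𝒟 : ℝ}
    (hK : ∀ i, 1 ≤ i → i ≤ n + 2 → ∀ p : Momentum, ‖iteratedFDeriv ℝ i (frameLevel μ K) p‖ ≤ 𝒦) (h𝒟 : 1 ≤ 𝒟)
    (hD : ∀ i, 1 ≤ i → i ≤ n + 2 → msD6 A₃ A₄ A₅ A₆ i ≤ 𝒟 ^ i) {Q : ℕ → ℝ}
    (hQ0 : ((bandBounds (show (-4 : ℝ) < -1.1 by norm_num) (show (-1.1 : ℝ) ≤ -0.1 by norm_num) (show (-0.1 : ℝ) < 0 by norm_num)).Dtmin - 2 * A)⁻¹ ≤ Q 0)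
    (hQ : ∀ m, 1 ≤ m → m ≤ n → ((bandBounds (show (-4 : ℝ) < -1.1 by norm_num) (show (-1.1 : ℝ) ≤ -0.1 by norm_num)
        (show (-0.1 : ℝ) < 0 by norm_num)).Dtmin - 2 * A)⁻¹ *
        ∑ j ∈ Finset.range m, (m.choose j : ℝ) * Q j * ((m - j + 1).factorial * 𝒦 * 𝒟 ^ (m - j)) ≤ Q m)
    {ρ : ℝ} (hρ : |ρ| < r) {e : ℝ} (he : |e| < r) (ϑ : ℝ) {D₁ R₁ D₂ R₂ : ℝ} (hD₁0 : 0 ≤ D₁) (hR₁0 : 0 ≤ R₁) (hD₂0 : 0 ≤ D₂) (hR₂0 : 0 ≤ R₂)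
    (hD₁ : ∀ j, 1 ≤ j → j ≤ n → 3 * msD6 A₃ A₄ A₅ A₆ j + |e| * (∑ l ∈ Finset.range (j + 1), (j.choose l : ℝ) * Q l) ≤ D₁ ^ j)
    (hR₁ : ∀ j, j ≤ n → (∑ l ∈ Finset.range (j + 1), (j.choose l : ℝ) * Q l) ≤ R₁ * D₁ ^ j)
    (hD₂ : ∀ j, 1 ≤ j → j ≤ n →
      3 * msD6 A₃ A₄ A₅ A₆ j + (|ρ| + |ϑ - π|) * ((∑ l ∈ Finset.range (j + 1), (j.choose l : ℝ) * Q l) + msD6 A₃ A₄ A₅ A₆ (j + 1)) ≤ D₂ ^ j)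
    (hR₂ : ∀ j, j ≤ n → (∑ l ∈ Finset.range (j + 1), (j.choose l : ℝ) * Q l) + msD6 A₃ A₄ A₅ A₆ (j + 1) ≤ R₂ * D₂ ^ j)
    {Ψ : ℝ → ℂ} (hΨ : ContDiff ℝ ∞ Ψ) {Jt : ℕ → ℝ} (hJt : ∀ a ≤ n, ∀ s, |iteratedDeriv a (fun s : ℝ => levelChartJac μ K (e, s)) s| ≤ Jt a)
    (θ φ : ℝ) :
    ‖iteratedDeriv n (fun ψ : ℝ => (levelChartJac μ K (e, φ + ψ) : ℝ) •
        Ψ (frameLevel μ K (levelPoint μ K e (φ + ψ) - (levelPoint μ K 0 ψ - levelPoint μ K ρ (ϑ + ψ))))) θ‖ ≤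
      ∑ a ∈ Finset.range (n + 1), (n.choose a : ℝ) * Jt a *
        ∑ c : OrderedFinpartition (n - a),
          ‖iteratedDeriv c.length Ψ (frameLevel μ K (levelPoint μ K e (φ + θ) - (levelPoint μ K 0 θ - levelPoint μ K ρ (ϑ + θ))))‖ *
            ((φ ^ 2 + |e| + (|ρ| + |ϑ - π|)) ^ c.length *
              ∏ j, ((c.partSize j + 2).factorial * 𝒦 * (3 * 𝒟) ^ (c.partSize j + 2) + (c.partSize j + 1).factorial * 𝒦 * R₁ * D₁ ^ c.partSize j +
                (c.partSize j + 1).factorial * 𝒦 * R₂ * D₂ ^ c.partSize j)) := by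
  set B₀ := bandBounds (show (-4 : ℝ) < -1.1 by norm_num) (show (-1.1 : ℝ) ≤ -0.1 by norm_num) (show (-0.1 : ℝ) < 0 by norm_num) with hB₀
  have hADt : 2 * A < B₀.Dtmin := by have := klCurveD_pos; linarith
  have h𝒦 : 0 ≤ 𝒦 := (norm_nonneg _).trans (hK 1 le_rfl (by omega) 0)
  refine norm_iteratedDeriv_loopIntegrand_ph_le_of_small_factor B₀ hA hADt hlo hhi hΨ hρ he ϑ φ θ hJt
    (G := fun j => (j + 2).factorial * 𝒦 * (3 * 𝒟) ^ (j + 2) + (j + 1).factorial * 𝒦 * R₁ * D₁ ^ j + (j + 1).factorial * 𝒦 * R₂ * D₂ ^ j)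
    fun j hj1 hj2 => ?_
  have hjk : j ≤ 4 := hj2.trans hn
  have h := abs_iteratedDeriv_partnerBand_ph_tangency_le_of_table hA hA20 hd hr hlo hhi hA₃ hA₄ hA₅ hA₆ hjk
    (fun i hi1 hi2 p => hK i hi1 (by omega) p) h𝒟 (fun i hi1 hi2 => hD i hi1 (by omega)) hQ0 (fun m hm1 hm2 => hQ m hm1 (hm2.trans hj2))
    hρ he ϑ hD₁0 hR₁0 hD₂0 hR₂0 (fun i hi1 hi2 => hD₁ i hi1 (hi2.trans hj2)) (fun i hi => hR₁ i (hi.trans hj2))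
    (fun i hi1 hi2 => hD₂ i hi1 (hi2.trans hj2)) (fun i hi => hR₂ i (hi.trans hj2)) θ φ
  refine h.trans ?_
  have h3 := three_smallFactor_le (a := (j + 2).factorial * 𝒦 * (3 * 𝒟) ^ (j + 2)) (b := (j + 1).factorial * 𝒦 * R₁ * D₁ ^ j)
    (c := (j + 1).factorial * 𝒦 * R₂ * D₂ ^ j) (x := φ ^ 2) (y := |e|) (z := |ρ| + |ϑ - π|)
    (by positivity) (by positivity) (by positivity) (by positivity) (abs_nonneg _) (by positivity)
  simpa only using h3

end Tangency

end Summit.HubbardSuperconductivity.HubbardSuperconductivity.Theorems.C4a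

end
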